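/-
HONEST FRAMING: certified error envelopes and provably optimal rounding/accumulation schemes for
low-precision formats under stated cost models; every table by two implementations; no hardware or
vendor claims.
-/
import Summits.Ventures.CertifiedArithmetic.LowPrec.OptChainLabelsRNEConverse

/-!
# The labelled chain law under TIES-UPWARD / TIES-TO-AWAY rounding (OPTIMA.md §B, T9(b),(e)):
# the constant `1 + U` is NEVER attained — strictness for every chain

T9(a): `acc + Σ x_i ≤ (1 + Σ u_{π_i}) · S_n` for every labelled chain; T9(b): attained under
round-to-nearest-even for every all-addition sequence.  Certificate C21 (e) observed that with
ties resolved AWAY from zero the inequality is strict on all 64 sampled rows.  This file proves it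
for EVERY nonempty chain (any precision sequence, additions and conversions alike), all
nonnegative grid data and every family of nearest roundings that resolves ties UPWARD
(`TiesUp`, or only at nonnegative arguments, `TiesUpNonneg` — all a chain of nonnegative data
meets, and satisfied verbatim by IEEE-754 roundTiesToAway; such nearest
maps exist for every format, `exists_roundNearest_tiesUp`): `acc + Σ x_i < (1 + U) · S_n` whenever
`S_n > 0` (`lchain_tiesUp_strict`, `R4_LabelledChainLawTiesAway_holds`).

THE ARGUMENT.  By `step_anatomy` a step that loses its full `u_π 2^K`, `2^K = ufp(S_n)`, has its
result `w = fl V ∈ [2^K, 2^(K+1))` exactly half an ulp BELOW its argument `V`; but then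
`w + ulp = w + 2^(K+1-π)` is a float (or `2^(K+1)`) at the same distance above `V`, and a
ties-upward map must take it (`step_loss_lt_of_tiesUp`).  So already the FIRST step is slack, and
the remaining steps lose at most their share by T9(a)'s deficit lemma.
-/

namespace Summit.Ventures.CertifiedArithmetic.LowPrec.Opt

open Literature.ComputerArithmetic.JeannerodRump2018

/-! ## Ties upward -/

/-- THE TIES-UPWARD RULE: among equally near candidates `fl t` is the largest — every float at
least as near to `t` as `fl t` lies below `fl t`.  For `t ≥ 0` this is IEEE-754 roundTiesToAway
(ties away from zero). -/
def TiesUp (p : ℕ) (emin : ℤ) (fl : ℚ → ℚ) : Prop :=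
  ∀ t f : ℚ, IsFloat p emin f → |t - f| ≤ |t - fl t| → f ≤ fl t

/-- TIES UPWARD ON NONNEGATIVE ARGUMENTS ONLY — all that a chain of nonnegative data ever meets.
IEEE-754 roundTiesToAway (ties away from zero) satisfies this predicate as stated, whatever it
does on negative arguments. -/
def TiesUpNonneg (p : ℕ) (emin : ℤ) (fl : ℚ → ℚ) : Prop :=
  ∀ t f : ℚ, 0 ≤ t → IsFloat p emin f → |t - f| ≤ |t - fl t| → f ≤ fl t

/-- Ties upward everywhere implies ties upward on nonnegative arguments. -/
theorem TiesUp.nonneg {p : ℕ} {emin : ℤ} {fl : ℚ → ℚ} (h : TiesUp p emin fl) :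
    TiesUpNonneg p emin fl :=
  fun t f _ hf hd => h t f hf hd

/-- ROUND-TO-NEAREST, TIES-UPWARD MAPS EXIST for every format: take any nearest map `f` and
replace `f t` by its mirror image `2t - f t` whenever that is a larger float. -/
theorem exists_roundNearest_tiesUp (p : ℕ) (emin : ℤ) :
    ∃ fl : ℚ → ℚ, IsRoundNearest p emin fl ∧ TiesUp p emin fl := by
  classical
  choose f hF hmin using exists_nearest p emin
  refine ⟨fun t => if IsFloat p emin (2 * t - f t) ∧ f t ≤ 2 * t - f t then 2 * t - f t else f t,
    ?_, ?_⟩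
  · intro t
    by_cases h : IsFloat p emin (2 * t - f t) ∧ f t ≤ 2 * t - f t
    · simp only [if_pos h]
      refine ⟨h.1, fun g hg => ?_⟩
      rw [show t - (2 * t - f t) = -(t - f t) by ring, abs_neg]
      exact hmin t g hg
    · simp only [if_neg h]
      exact ⟨hF t, hmin t⟩
  · intro t g hg hle
    by_cases h : IsFloat p emin (2 * t - f t) ∧ f t ≤ 2 * t - f t
    · simp only [if_pos h] at hle ⊢
      rw [show t - (2 * t - f t) = -(t - f t) by ring, abs_neg] at hle
      rcases abs_eq_abs.mp (le_antisymm hle (hmin t g hg)) with h1 | h1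
      · linarith [h.2]
      · linarith
    · simp only [if_neg h] at hle ⊢
      by_contra hlt
      push Not at hlt
      rcases abs_eq_abs.mp (le_antisymm hle (hmin t g hg)) with h1 | h1
      · linarith
      · exact h ⟨by rw [show 2 * t - f t = g by linarith]; exact hg, by linarith⟩

/-- A ties-upward nearest FAMILY (one map per precision) exists. -/
theorem exists_tiesUp_family (emin : ℤ) :
    ∃ fl : ℕ → ℚ → ℚ, ∀ π, IsRoundNearest π emin (fl π) ∧ TiesUp π emin (fl π) := by
  choose fl h using fun π => exists_roundNearest_tiesUp π emin
  exact ⟨fl, h⟩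

/-! ## No step is tight under ties upward -/

/-- The float just above a float `w ∈ [2^K, 2^(K+1))` of `F(p)`: `w + 2^(K+1-p) ∈ F(p)`
(when `emin + p ≤ K + 1`; it may be `2^(K+1)`). -/
theorem isFloat_add_ulp {p : ℕ} {emin K : ℤ} {w : ℚ} (hp : 1 ≤ p) (hw : IsFloat p emin w)
    (hKw : (2 : ℚ) ^ K ≤ w) (hwlt : w < (2 : ℚ) ^ (K + 1)) (heK : emin + p ≤ K + 1) :
    IsFloat p emin (w + (2 : ℚ) ^ (K + 1 - p)) := by
  have h2 : (2 : ℚ) ≠ 0 := by norm_num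
  have hKpos : (0 : ℚ) < (2 : ℚ) ^ (K + 1 - p) := zpow_pos (by norm_num) _
  obtain ⟨k, hk⟩ := IsFloat.exists_int_mul_zpow hw hKw
  have hk_lt : k < (2 : ℤ) ^ p := by
    have h1 : (k : ℚ) * (2 : ℚ) ^ (K + 1 - p) < (2 : ℚ) ^ (p : ℤ) * (2 : ℚ) ^ (K + 1 - p) := by
      rw [← zpow_add₀ h2, show (p : ℤ) + (K + 1 - p) = K + 1 by ring, ← hk]; exact hwlt
    have h3 : (k : ℚ) < (2 : ℚ) ^ (p : ℤ) := lt_of_mul_lt_mul_right h1 hKpos.le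
    rw [zpow_natCast] at h3
    exact_mod_cast h3
  have hk_pos : 0 < k := by
    have h1 : (0 : ℚ) * (2 : ℚ) ^ (K + 1 - p) < (k : ℚ) * (2 : ℚ) ^ (K + 1 - p) := by
      rw [zero_mul, ← hk]; exact lt_of_lt_of_le (zpow_pos (by norm_num) _) hKw
    have h3 : (0 : ℚ) < k := lt_of_mul_lt_mul_right h1 hKpos.le
    exact_mod_cast h3
  by_cases hk1 : k + 1 < (2 : ℤ) ^ p
  · refine ⟨k + 1, K + 1 - p, ?_, by omega, ?_⟩
    · rw [abs_of_pos (by omega)]; exact hk1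
    · rw [hk]; push_cast; ring
  · have hkeq : ((k + 1 : ℤ) : ℚ) = (2 : ℚ) ^ (p : ℤ) := by
      rw [zpow_natCast]; exact_mod_cast (show k + 1 = (2 : ℤ) ^ p by omega)
    have hf2 : w + (2 : ℚ) ^ (K + 1 - p) = (2 : ℚ) ^ (K + 1) := by
      have : w + (2 : ℚ) ^ (K + 1 - p) = ((k + 1 : ℤ) : ℚ) * (2 : ℚ) ^ (K + 1 - p) := by
        rw [hk]; push_cast; ring
      rw [this, hkeq, ← zpow_add₀ h2]; congr 1; ring
    rw [hf2]; exact PTree.isFloat_two_zpow hp (by omega)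

/-- UNDER TIES UPWARD NO STEP IS TIGHT: a ties-upward nearest rounding into `F(p)` of a
nonnegative grid number `V`, followed by an admissible chain with final value `< 2^(K+1)`, loses
STRICTLY LESS than `u_p 2^K` — a full loss would put `V` midway between `fl V` and the next float
up, which ties-upward must prefer. -/
theorem step_loss_lt_of_tiesUpNonneg {emin : ℤ} {p : ℕ} (hp1 : 1 ≤ p) {fl : ℚ → ℚ}
    (hfl : IsRoundNearest p emin fl) (htu : TiesUpNonneg p emin fl) {V : ℚ} (hV0 : 0 ≤ V)
    (hVG : IsGrid emin V) {ss : List LStep} (hss : ∀ t ∈ ss, t.OK emin) {K : ℤ}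
    (hK : lchainEval (fl V) ss < (2 : ℚ) ^ (K + 1)) :
    V - fl V < unitRoundoff p * (2 : ℚ) ^ K := by
  obtain ⟨hle, htight⟩ := step_anatomy hp1 hfl hV0 hVG hss hK
  refine lt_of_le_of_ne hle (fun ht => ?_)
  obtain ⟨-, hKw, hVlt, heK⟩ := htight ht
  rw [mul_comm, two_zpow_mul_unitRoundoff] at ht
  have h2 : (2 : ℚ) ≠ 0 := by norm_num
  have hpos : (0 : ℚ) < (2 : ℚ) ^ (K - p) := zpow_pos (by norm_num) _
  have hwlt : fl V < (2 : ℚ) ^ (K + 1) := by linarith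
  have hd1 : (2 : ℚ) ^ (K + 1 - p) = 2 * (2 : ℚ) ^ (K - p) := by
    rw [show K + 1 - (p : ℤ) = (K - p) + 1 by ring, zpow_add_one₀ h2, mul_comm]
  have hf := isFloat_add_ulp hp1 (hfl V).1 hKw hwlt (by omega)
  have hdist : |V - (fl V + (2 : ℚ) ^ (K + 1 - p))| ≤ |V - fl V| := by
    have hVf : V - (fl V + (2 : ℚ) ^ (K + 1 - p)) = -((2 : ℚ) ^ (K - p)) := by
      rw [hd1]; linarith
    rw [hVf, ht, abs_neg, abs_of_pos hpos]
  have := htu V _ hV0 hf hdist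
  have hKpos : (0 : ℚ) < (2 : ℚ) ^ (K + 1 - p) := zpow_pos (by norm_num) _
  linarith

/-- `step_loss_lt_of_tiesUpNonneg` for maps resolving ties upward everywhere. -/
theorem step_loss_lt_of_tiesUp {emin : ℤ} {p : ℕ} (hp1 : 1 ≤ p) {fl : ℚ → ℚ}
    (hfl : IsRoundNearest p emin fl) (htu : TiesUp p emin fl) {V : ℚ} (hV0 : 0 ≤ V)
    (hVG : IsGrid emin V) {ss : List LStep} (hss : ∀ t ∈ ss, t.OK emin) {K : ℤ}
    (hK : lchainEval (fl V) ss < (2 : ℚ) ^ (K + 1)) :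
    V - fl V < unitRoundoff p * (2 : ℚ) ^ K :=
  step_loss_lt_of_tiesUpNonneg hp1 hfl htu.nonneg hV0 hVG hss hK

/-! ## Strictness for every nonempty chain -/

/-- THE LABELLED CHAIN LAW IS STRICT UNDER TIES UPWARD ON NONNEGATIVE ARGUMENTS (T9(b)/(e), for
every chain; covers IEEE roundTiesToAway): for every NONEMPTY admissible chain (any precision
sequence, additions and conversions, nonnegative grid data, start value `acc ≥ 0` on the grid)
whose nearest roundings resolve ties upward at nonnegative arguments,
`acc + Σ x_i < (1 + Σ u_{π_i}) · S_n` whenever `S_n > 0`. -/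
theorem lchain_tiesUpNonneg_strict {emin : ℤ} (s : LStep) (ss : List LStep) (acc : ℚ)
    (hacc0 : 0 ≤ acc) (haccG : IsGrid emin acc)
    (hss : ∀ t ∈ s :: ss, t.OK emin ∧ TiesUpNonneg t.prec emin t.fl)
    (hpos : 0 < lchainEval acc (s :: ss)) :
    acc + xsum (s :: ss) < (1 + usum (s :: ss)) * lchainEval acc (s :: ss) := by
  obtain ⟨⟨hp1, hfl, hx0, hxG⟩, htu⟩ := hss s (by simp)
  have hrestOK : ∀ t ∈ ss, t.OK emin := fun t ht => (hss t (by simp [ht])).1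
  set c := lchainEval acc (s :: ss) with hc
  set K := Int.log 2 c with hKdef
  have hlow : ((2 : ℕ) : ℚ) ^ K ≤ c := Int.zpow_log_le_self (by norm_num) hpos
  have hupK : c < ((2 : ℕ) : ℚ) ^ (K + 1) := Int.lt_zpow_succ_log_self (by norm_num) _
  push_cast at hlow hupK
  rw [hc, lchainEval_cons] at hupK
  have hV0 : 0 ≤ acc + s.x := by linarith
  have hVG : IsGrid emin (acc + s.x) := haccG.add hxG
  have hmF : IsFloat s.prec emin (s.fl (acc + s.x)) := (hfl _).1
  have hm0 : 0 ≤ s.fl (acc + s.x) := le_fl_of_isFloat_le hfl (isFloat_zero _ _) hV0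
  have hhead := step_loss_lt_of_tiesUpNonneg hp1 hfl htu hV0 hVG hrestOK hupK
  have htail := lchain_deficit_le ss _ hm0 (isGrid_of_isFloat hmF) hrestOK K hupK
  have hmono : usum (s :: ss) * (2 : ℚ) ^ K ≤ usum (s :: ss) * c :=
    mul_le_mul_of_nonneg_left hlow (usum_nonneg _)
  have hring : (1 + usum (s :: ss)) * c = c + usum (s :: ss) * c := by ring
  rw [hring]
  rw [usum_cons, add_mul] at hmono
  rw [hc, lchainEval_cons, xsum_cons, usum_cons] at *
  linarith

/-- THE LABELLED CHAIN LAW IS STRICT UNDER TIES UPWARD (T9(b)/(e), for every chain): for every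
NONEMPTY admissible chain (any precision sequence, additions and conversions, nonnegative grid
data, start value `acc ≥ 0` on the grid) whose nearest roundings resolve ties upward,
`acc + Σ x_i < (1 + Σ u_{π_i}) · S_n` whenever `S_n > 0`.  (`lchain_tiesUpNonneg_strict` is the
same statement asking for the tie rule at nonnegative arguments only.) -/
theorem lchain_tiesUp_strict {emin : ℤ} (s : LStep) (ss : List LStep) (acc : ℚ)
    (hacc0 : 0 ≤ acc) (haccG : IsGrid emin acc)
    (hss : ∀ t ∈ s :: ss, t.OK emin ∧ TiesUp t.prec emin t.fl)
    (hpos : 0 < lchainEval acc (s :: ss)) :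
    acc + xsum (s :: ss) < (1 + usum (s :: ss)) * lchainEval acc (s :: ss) := by
  obtain ⟨⟨hp1, hfl, hx0, hxG⟩, htu⟩ := hss s (by simp)
  have hrestOK : ∀ t ∈ ss, t.OK emin := fun t ht => (hss t (by simp [ht])).1
  set c := lchainEval acc (s :: ss) with hc
  set K := Int.log 2 c with hKdef
  have hlow : ((2 : ℕ) : ℚ) ^ K ≤ c := Int.zpow_log_le_self (by norm_num) hpos
  have hupK : c < ((2 : ℕ) : ℚ) ^ (K + 1) := Int.lt_zpow_succ_log_self (by norm_num) _
  push_cast at hlow hupK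
  rw [hc, lchainEval_cons] at hupK
  have hV0 : 0 ≤ acc + s.x := by linarith
  have hVG : IsGrid emin (acc + s.x) := haccG.add hxG
  have hmF : IsFloat s.prec emin (s.fl (acc + s.x)) := (hfl _).1
  have hm0 : 0 ≤ s.fl (acc + s.x) := le_fl_of_isFloat_le hfl (isFloat_zero _ _) hV0
  have hhead := step_loss_lt_of_tiesUp hp1 hfl htu hV0 hVG hrestOK hupK
  have htail := lchain_deficit_le ss _ hm0 (isGrid_of_isFloat hmF) hrestOK K hupK
  have hmono : usum (s :: ss) * (2 : ℚ) ^ K ≤ usum (s :: ss) * c :=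
    mul_le_mul_of_nonneg_left hlow (usum_nonneg _)
  have hring : (1 + usum (s :: ss)) * c = c + usum (s :: ss) * c := by ring
  rw [hring]
  rw [usum_cons, add_mul] at hmono
  rw [hc, lchainEval_cons, xsum_cons, usum_cons] at *
  linarith

/-! ## Registered form -/

/-- LABELLED CHAIN LAW, TIES-TO-AWAY STRICTNESS (OPTIMA.md §B, T9(b)/(e); certificate C21 (e):
64/64 rows): (1) for every nonempty admissible labelled chain whose nearest roundings resolve ties
upward (= away from zero on the nonnegative values that occur), all nonnegative grid data and
`S_n > 0`: `acc + Σ x_i < (1 + Σ u_{π_i}) · S_n` — the constant of T9(a) is never attained;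
(2) such rounding families exist for every `emin`. -/
def R4_LabelledChainLawTiesAway : Prop :=
  (∀ (emin : ℤ) (acc : ℚ) (ss : List LStep), ss ≠ [] → 0 ≤ acc → IsGrid emin acc →
    (∀ t ∈ ss, t.OK emin ∧ TiesUp t.prec emin t.fl) → 0 < lchainEval acc ss →
    acc + xsum ss < (1 + usum ss) * lchainEval acc ss) ∧
  (∀ emin : ℤ, ∃ fl : ℕ → ℚ → ℚ, ∀ π, IsRoundNearest π emin (fl π) ∧ TiesUp π emin (fl π))

/-- `R4_LabelledChainLawTiesAway` holds. -/
theorem R4_LabelledChainLawTiesAway_holds : R4_LabelledChainLawTiesAway := by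
  refine ⟨?_, exists_tiesUp_family⟩
  intro emin acc ss hne hacc0 haccG hss hpos
  cases ss with
  | nil => exact absurd rfl hne
  | cons s rest => exact lchain_tiesUp_strict s rest acc hacc0 haccG hss hpos

/-- LABELLED CHAIN LAW, TIES-TO-AWAY STRICTNESS, IEEE FORM (T9(b)/(e)): as clause (1) of
`R4_LabelledChainLawTiesAway`, but asking the tie rule only at nonnegative arguments
(`TiesUpNonneg`), which IEEE-754 roundTiesToAway satisfies verbatim. -/
def R4_LabelledChainLawTiesAwayNonneg : Prop :=
  ∀ (emin : ℤ) (acc : ℚ) (ss : List LStep), ss ≠ [] → 0 ≤ acc → IsGrid emin acc →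
    (∀ t ∈ ss, t.OK emin ∧ TiesUpNonneg t.prec emin t.fl) → 0 < lchainEval acc ss →
    acc + xsum ss < (1 + usum ss) * lchainEval acc ss

/-- `R4_LabelledChainLawTiesAwayNonneg` holds. -/
theorem R4_LabelledChainLawTiesAwayNonneg_holds : R4_LabelledChainLawTiesAwayNonneg := by
  intro emin acc ss hne hacc0 haccG hss hpos
  cases ss with
  | nil => exact absurd rfl hne
  | cons s rest => exact lchain_tiesUpNonneg_strict s rest acc hacc0 haccG hss hpos

end Summit.Ventures.CertifiedArithmetic.LowPrec.Opt
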